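import Summits.QuantumFields.BalabanUV.T4Continuum.Support.NE7CoordinateBlockMeanLift
import HarnessLib

/-!
# NE7LongitudinalLineLift — THE LONGITUDINAL LIFT `llift M N κ`: an exact right inverse of Bałaban's block-LINE average
# `f ↦ M⁻¹ Σ_{s<M} Σ_{i<M} f(y + (s+i)e_κ)` along the direction `κ`, commuting with transverse translations (its L² bound `1154/M²` is the sequel `NE7LongitudinalLineLiftEnergy`)

Lineage `b2b-balaban-t4-ne7-p1` (CRUX PROVER NE7 #1 = OWNER of BINDER row NE7), generation 116 — third brick of the UNIFORM UPPER BOUND for the flat-background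
effective quadratic form (ROAD-G116 §6(U)).  The straight `k`-fold average of the `κ`-component of a fine 1-form (✓ `NE3BlockLineAverage.iterate_Qcoarse_apply`)
is, in the direction `κ`, the block mean of the LINE SUM of length `M = L^k`; an exact right inverse in that direction is obtained from the one-coordinate
block-mean-exact lift ✓ `NE7CoordinateBlockMeanLift.clift` by a DISCRETE DERIVATIVE: for a fine function `F` that is blockwise constant in `κ` and `NM`-periodic,
  `m̂ F (y) = N⁻¹ Σ_{k<N} F(y + kM e_κ)` (the mean over the `N` coarse translates — constant along `κ`), `G = F − m̂ F` (mean zero over the translates),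
  `U (y) = −N⁻¹ Σ_{k<N} (N − k) • G(y + kM e_κ)` (the periodic coarse primitive: `U(y + M e_κ) − U(y) = G(y)`),
  **`llift F (y) = clift M κ U (y + e_κ) − clift M κ U (y) + M⁻¹ • m̂ F (y)`**.
WHAT ([folklore]; defs `tmean`, `tprim`, `llift`; 0 sorry): `tmean_shift`∕`tmean_start` (constancy along `κ`), `sum_translates_sub_tmean` (`Σ_k G(y + kMe_κ) = 0`),
**`tprim_step`** (`U(y + Me_κ) − U y = G y`), **`sum_llift_line`** (EXACTNESS: `Σ_{s<M} Σ_{i<M} llift F (y + (s+i) e_κ) = M • F y` at block starts — the line sum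
telescopes the derivative, the block sum of `clift U` is exact, `m̂` is constant along `κ`), linearity, `llift_translate` (commutes with translations `v`, `v_κ = 0`), periodicity, blockwise constancy in the other
directions, `llift_map`.
HONEST FRAMING: pure lattice calculus (kinematics of block averaging); nothing about Bałaban's minimisers; NOT NE7 as a spine node; spine 0∕9; NOT infinite volume,
NOT mass gap, NOT BetaPertH, NOT Clay.
-/

set_option autoImplicit false

open scoped BigOperators
open Finset

namespace Summit.QuantumFields.BalabanUV.T4Continuum.NE7LongitudinalLineLift

open Literature.MathematicalPhysics.QuantumFieldTheory.Balaban1983to89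
open B7Prop1Explicit
open T4AveragingDeficitWallBoundary (periodBox mem_periodBox sum_periodBox_shift)
open SmoothRefineBlocks (blk res blk_add_res res_nonneg res_lt blk_res_eq_of blk_res_add_period res_add_e_self res_add_e_ne)
open NE7CoordinateLiftWeights
open NE7CoordinateBlockMeanLift

noncomputable section

variable {d : ℕ}

section Lift

variable {X : Type*} [AddCommGroup X] [Module ℝ X]

/-! ## §1 The mean over the coarse translates and the periodic coarse primitive -/

/-- The mean over the `N` coarse translates along `κ`: `m̂ F (y) = N⁻¹ Σ_{k<N} F(y + kM e_κ)`. [folklore] -/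
def tmean (M N : ℕ) (κ : Fin d) (F : Site d → X) : Site d → X :=
  fun y => (N : ℝ)⁻¹ • ∑ k ∈ range N, F (y + ((M : ℤ) * (k : ℤ)) • e κ)

/-- The periodic coarse primitive along `κ`: `U (y) = −N⁻¹ Σ_{k<N} (N − k) • G(y + kM e_κ)`. [folklore] -/
def tprim (M N : ℕ) (κ : Fin d) (G : Site d → X) : Site d → X :=
  fun y => -((N : ℝ)⁻¹ • ∑ k ∈ range N, ((N : ℝ) - k) • G (y + ((M : ℤ) * (k : ℤ)) • e κ))

/-- **THE LONGITUDINAL LIFT** `llift F (y) = clift M κ U (y + e_κ) − clift M κ U (y) + M⁻¹ • m̂ F (y)`, `U` the periodic coarse primitive of `F − m̂ F`. [folklore] -/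
def llift (M N : ℕ) (κ : Fin d) (F : Site d → X) : Site d → X :=
  fun y => clift M κ (tprim M N κ (F - tmean M N κ F)) (y + e κ) - clift M κ (tprim M N κ (F - tmean M N κ F)) y
    + (M : ℝ)⁻¹ • tmean M N κ F y

omit [AddCommGroup X] [Module ℝ X] in
/-- Coarse steps compose: `y + kM e_κ + M e_κ = y + (k+1)M e_κ`. [folklore] -/
theorem add_mul_succ (M : ℕ) (y : Site d) (κ : Fin d) (k : ℕ) :
    y + ((M : ℤ) * (k : ℤ)) • e κ + (M : ℤ) • e κ = y + ((M : ℤ) * ((k + 1 : ℕ) : ℤ)) • e κ := by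
  push_cast
  module

/-- **`m̂ F` is invariant under the coarse translation `M e_κ`** (for `F` with `F(y + NM e_κ) = F y`). [folklore] -/
theorem tmean_shift {M N : ℕ} (κ : Fin d) {F : Site d → X} (hF : ∀ y, F (y + ((M : ℤ) * (N : ℤ)) • e κ) = F y) (y : Site d) :
    tmean M N κ F (y + (M : ℤ) • e κ) = tmean M N κ F y := by
  simp only [tmean]
  congr 1
  have h : ∀ k : ℕ, F (y + (M : ℤ) • e κ + ((M : ℤ) * (k : ℤ)) • e κ) = F (y + ((M : ℤ) * ((k + 1 : ℕ) : ℤ)) • e κ) := fun k => by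
    rw [add_right_comm, add_mul_succ]
  simp only [h]
  have h2 := Finset.sum_range_succ' (fun k => F (y + ((M : ℤ) * (k : ℤ)) • e κ)) N
  have h3 := Finset.sum_range_succ (fun k => F (y + ((M : ℤ) * (k : ℤ)) • e κ)) N
  simp only [Nat.cast_zero, mul_zero, zero_smul, add_zero] at h2
  rw [hF] at h3
  have : ∑ k ∈ range N, F (y + ((M : ℤ) * ((k + 1 : ℕ) : ℤ)) • e κ) + F y = ∑ k ∈ range N, F (y + ((M : ℤ) * (k : ℤ)) • e κ) + F y := by
    rw [← h2, h3]
  exact add_right_cancel this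

/-- `m̂ F` is invariant under every multiple of the coarse translation. [folklore] -/
theorem tmean_shift_mul {M N : ℕ} (κ : Fin d) {F : Site d → X} (hF : ∀ y, F (y + ((M : ℤ) * (N : ℤ)) • e κ) = F y) (y : Site d) :
    ∀ k : ℕ, tmean M N κ F (y + ((M : ℤ) * (k : ℤ)) • e κ) = tmean M N κ F y
  | 0 => by simp
  | k + 1 => by rw [← add_mul_succ, tmean_shift κ hF, tmean_shift_mul κ hF y k]

/-- `m̂ F` is blockwise constant in `κ` if `F` is. [folklore] -/
theorem tmean_bconst {M : ℕ} (hM : 1 ≤ M) (N : ℕ) (κ : Fin d) {F : Site d → X} (hFB : ∀ y, F y = F (y - (res M y κ) • e κ)) (y : Site d) :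
    tmean M N κ F y = tmean M N κ F (y - (res M y κ) • e κ) := by
  simp only [tmean]
  congr 1
  refine Finset.sum_congr rfl fun k _ => apply_eq_of_start hFB ?_
  have h1 : res M (y + ((M : ℤ) * (k : ℤ)) • e κ) = res M y := (blk_res_add_period hM y k κ).2
  have h2 : res M (y - (res M y κ) • e κ + ((M : ℤ) * (k : ℤ)) • e κ) κ = 0 := by
    rw [(blk_res_add_period hM _ k κ).2]; exact res_start M y κ
  rw [h1, h2, zero_smul, sub_zero]
  abel

/-- **`m̂ F` is constant along `κ` over two blocks read from a block start**: `m̂ F (y + t e_κ) = m̂ F (y)` for `res y_κ = 0`, `0 ≤ t < 2M`. [folklore] -/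
theorem tmean_start {M N : ℕ} (hM : 1 ≤ M) (κ : Fin d) {F : Site d → X} (hF : ∀ y, F (y + ((M : ℤ) * (N : ℤ)) • e κ) = F y)
    (hFB : ∀ y, F y = F (y - (res M y κ) • e κ)) {y : Site d} (hy : res M y κ = 0) {t : ℤ} (h0 : 0 ≤ t) (h1 : t < 2 * (M : ℤ)) :
    tmean M N κ F (y + t • e κ) = tmean M N κ F y := by
  by_cases ht : t < M
  · exact apply_start hM (tmean_bconst hM N κ hFB) hy h0 ht
  · have hy' : res M (y + (M : ℤ) • e κ) κ = 0 := by rw [res_add_M hM]; exact hy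
    have h := apply_start hM (tmean_bconst hM N κ hFB) hy' (s := t - M) (by omega) (by omega)
    rw [add_assoc, ← add_smul, add_sub_cancel] at h
    rw [h, tmean_shift κ hF]

/-- **The translates of `G = F − m̂ F` sum to zero**: `Σ_{k<N} G(y + kM e_κ) = 0` (`N ≥ 1`). [folklore] -/
theorem sum_translates_sub_tmean {M N : ℕ} (hN : 1 ≤ N) (κ : Fin d) {F : Site d → X} (hF : ∀ y, F (y + ((M : ℤ) * (N : ℤ)) • e κ) = F y)
    (y : Site d) : ∑ k ∈ range N, (F - tmean M N κ F) (y + ((M : ℤ) * (k : ℤ)) • e κ) = 0 := by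
  have hN0 : (N : ℝ) ≠ 0 := by exact_mod_cast (by omega : N ≠ 0)
  simp only [Pi.sub_apply, Finset.sum_sub_distrib, tmean_shift_mul κ hF y, Finset.sum_const, Finset.card_range,
    ← Nat.cast_smul_eq_nsmul ℝ]
  simp only [tmean, smul_smul, mul_inv_cancel₀ hN0, one_smul, sub_self]

/-- **THE PRIMITIVE STEPS BY `G`**: `U(y + M e_κ) − U(y) = G(y)` whenever `Σ_{k<N} G(y + kM e_κ) = 0` and `G(y + NM e_κ) = G y` (`N ≥ 1`). [folklore] -/
theorem tprim_step {M N : ℕ} (hN : 1 ≤ N) (κ : Fin d) {G : Site d → X} (hG : ∀ y, G (y + ((M : ℤ) * (N : ℤ)) • e κ) = G y)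
    (hG0 : ∀ y, ∑ k ∈ range N, G (y + ((M : ℤ) * (k : ℤ)) • e κ) = 0) (y : Site d) :
    tprim M N κ G (y + (M : ℤ) • e κ) - tprim M N κ G y = G y := by
  have hN0 : (N : ℝ) ≠ 0 := by exact_mod_cast (by omega : N ≠ 0)
  have hA : ∑ k ∈ range N, ((N : ℝ) - k) • G (y + (M : ℤ) • e κ + ((M : ℤ) * (k : ℤ)) • e κ)
      = ∑ k ∈ range N, ((N : ℝ) - k) • G (y + ((M : ℤ) * (k : ℤ)) • e κ) - (N : ℝ) • G y := by
    set f : ℕ → X := fun k => G (y + ((M : ℤ) * (k : ℤ)) • e κ) with hf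
    have hfN : f N = f 0 := by simp only [hf, Nat.cast_zero, mul_zero, zero_smul, add_zero, hG]
    have hf0 : f 0 = G y := by simp [hf]
    have hsum : ∑ k ∈ range N, f k = 0 := hG0 y
    have h1 : ∀ k : ℕ, G (y + (M : ℤ) • e κ + ((M : ℤ) * (k : ℤ)) • e κ) = f (k + 1) := fun k => by
      simp only [hf]; rw [add_right_comm, add_mul_succ]
    have hsplit : ∀ k : ℕ, ((N : ℝ) - k) • f (k + 1) = ((N : ℝ) - ((k + 1 : ℕ) : ℝ)) • f (k + 1) + f (k + 1) := fun k => by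
      rw [Nat.cast_succ]
      nth_rewrite 3 [← one_smul ℝ (f (k + 1))]
      rw [← add_smul]; congr 1; ring
    simp only [h1, hsplit, Finset.sum_add_distrib]
    have hg := Finset.sum_range_succ' (fun j => ((N : ℝ) - j) • f j) N
    have hg' := Finset.sum_range_succ (fun j => ((N : ℝ) - j) • f j) N
    simp only [Nat.cast_zero, sub_zero, sub_self, zero_smul, add_zero] at hg hg'
    have hh := Finset.sum_range_succ' f N
    have hh' := Finset.sum_range_succ f N
    have e1 : ∑ k ∈ range N, ((N : ℝ) - ((k + 1 : ℕ) : ℝ)) • f (k + 1) = ∑ k ∈ range N, ((N : ℝ) - k) • f k - (N : ℝ) • f 0 := by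
      rw [eq_sub_iff_add_eq, ← hg, hg']
    have e2 : ∑ k ∈ range N, f (k + 1) = 0 := by
      have h := hh.symm.trans hh'
      rw [hsum, hfN, zero_add] at h
      simpa using h
    rw [e1, e2, add_zero, hf0]
  simp only [tprim]
  rw [hA, smul_sub, smul_smul, inv_mul_cancel₀ hN0, one_smul]
  abel

/-- `tprim` preserves blockwise constancy in `κ`. [folklore] -/
theorem tprim_bconst {M : ℕ} (hM : 1 ≤ M) (N : ℕ) (κ : Fin d) {G : Site d → X} (hGB : ∀ y, G y = G (y - (res M y κ) • e κ)) (y : Site d) :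
    tprim M N κ G y = tprim M N κ G (y - (res M y κ) • e κ) := by
  simp only [tprim]
  congr 2
  refine Finset.sum_congr rfl fun k _ => ?_
  congr 1
  refine apply_eq_of_start hGB ?_
  have h1 : res M (y + ((M : ℤ) * (k : ℤ)) • e κ) = res M y := (blk_res_add_period hM y k κ).2
  have h2 : res M (y - (res M y κ) • e κ + ((M : ℤ) * (k : ℤ)) • e κ) κ = 0 := by
    rw [(blk_res_add_period hM _ k κ).2]; exact res_start M y κ
  rw [h1, h2, zero_smul, sub_zero]
  abel

/-- `tmean` commutes with translations. [folklore] -/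
theorem tmean_translate (M N : ℕ) (κ : Fin d) (F : Site d → X) (v : Site d) :
    tmean M N κ (fun y => F (y + v)) = fun y => tmean M N κ F (y + v) := by
  funext y
  simp only [tmean, add_right_comm _ v]

/-- `tprim` commutes with translations. [folklore] -/
theorem tprim_translate (M N : ℕ) (κ : Fin d) (G : Site d → X) (v : Site d) :
    tprim M N κ (fun y => G (y + v)) = fun y => tprim M N κ G (y + v) := by
  funext y
  simp only [tprim, add_right_comm _ v]

/-- `tmean` is subtractive. [folklore] -/
theorem tmean_sub (M N : ℕ) (κ : Fin d) (F G : Site d → X) : tmean M N κ (F - G) = tmean M N κ F - tmean M N κ G := by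
  funext y
  simp only [tmean, Pi.sub_apply, Finset.sum_sub_distrib, smul_sub]

/-- `tprim` is subtractive. [folklore] -/
theorem tprim_sub (M N : ℕ) (κ : Fin d) (F G : Site d → X) : tprim M N κ (F - G) = tprim M N κ F - tprim M N κ G := by
  funext y
  simp only [tprim, Pi.sub_apply, smul_sub, Finset.sum_sub_distrib]
  abel

/-- `tmean` commutes with real-linear maps of the values. [folklore] -/
theorem tmean_map {Y : Type*} [AddCommGroup Y] [Module ℝ Y] (φ : X →ₗ[ℝ] Y) (M N : ℕ) (κ : Fin d) (F : Site d → X) (y : Site d) :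
    φ (tmean M N κ F y) = tmean M N κ (fun x => φ (F x)) y := by
  simp only [tmean, map_smul, map_sum]

/-- `tprim` commutes with real-linear maps of the values. [folklore] -/
theorem tprim_map {Y : Type*} [AddCommGroup Y] [Module ℝ Y] (φ : X →ₗ[ℝ] Y) (M N : ℕ) (κ : Fin d) (G : Site d → X) (y : Site d) :
    φ (tprim M N κ G y) = tprim M N κ (fun x => φ (G x)) y := by
  simp only [tprim, map_neg, map_smul, map_sum]

/-! ## §2 The longitudinal lift: algebra -/

/-- `llift` is subtractive. [folklore] -/
theorem llift_sub (M N : ℕ) (κ : Fin d) (F G : Site d → X) : llift M N κ (F - G) = llift M N κ F - llift M N κ G := by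
  funext y
  simp only [llift, tmean_sub, Pi.sub_apply, smul_sub]
  rw [show F - G - (tmean M N κ F - tmean M N κ G) = (F - tmean M N κ F) - (G - tmean M N κ G) by abel, tprim_sub, clift_sub]
  simp only [Pi.sub_apply]
  abel

/-- **`llift` commutes with the translations `v` with `v_κ = 0`** (all transverse translations). [folklore] -/
theorem llift_translate (M N : ℕ) (κ : Fin d) (F : Site d → X) (v : Site d) (hv : v κ = 0) :
    llift M N κ (fun y => F (y + v)) = fun y => llift M N κ F (y + v) := by
  have hMv : (M : ℤ) ∣ v κ := by rw [hv]; exact dvd_zero _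
  funext y
  simp only [llift]
  rw [tmean_translate]
  have hG : ((fun y => F (y + v)) - fun y => tmean M N κ F (y + v)) = fun y => (F - tmean M N κ F) (y + v) := rfl
  rw [hG, tprim_translate, clift_translate M κ _ v hMv]
  simp only [add_right_comm y (e κ) v]

/-- `llift` commutes with real-linear maps of the values. [folklore] -/
theorem llift_map {Y : Type*} [AddCommGroup Y] [Module ℝ Y] (φ : X →ₗ[ℝ] Y) (M N : ℕ) (κ : Fin d) (F : Site d → X) (y : Site d) :
    φ (llift M N κ F y) = llift M N κ (fun x => φ (F x)) y := by
  have hG : (fun x => φ ((F - tmean M N κ F) x)) = (fun x => φ (F x)) - tmean M N κ (fun x => φ (F x)) := by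
    funext x; simp only [Pi.sub_apply, map_sub, tmean_map]
  simp only [llift, map_add, map_sub, map_smul, clift_map, tprim_map, tmean_map, hG]

/-- `llift` preserves values in a submodule. [folklore] -/
theorem llift_mem (K : Submodule ℝ X) (M N : ℕ) (κ : Fin d) {F : Site d → X} (hF : ∀ y, F y ∈ K) (y : Site d) : llift M N κ F y ∈ K := by
  have hT : ∀ y, tmean M N κ F y ∈ K := fun y => K.smul_mem _ (K.sum_mem fun k _ => hF _)
  have hG : ∀ y, (F - tmean M N κ F) y ∈ K := fun y => K.sub_mem (hF y) (hT y)
  have hU : ∀ y, tprim M N κ (F - tmean M N κ F) y ∈ K := fun y =>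
    K.neg_mem (K.smul_mem _ (K.sum_mem fun k _ => K.smul_mem _ (hG _)))
  exact K.add_mem (K.sub_mem (clift_mem K M κ hU _) (clift_mem K M κ hU _)) (K.smul_mem _ (hT _))

/-- `llift` preserves periodicity (period `MN`, every direction). [folklore] -/
theorem llift_per {M N : ℕ} (κ : Fin d) {F : Site d → X} (hFP : ∀ (y : Site d) (μ : Fin d), F (y + ((M : ℤ) * (N : ℤ)) • e μ) = F y) (y : Site d) (μ : Fin d) :
    llift M N κ F (y + ((M : ℤ) * (N : ℤ)) • e μ) = llift M N κ F y := by
  have hT : ∀ (w : Site d) (μ' : Fin d), tmean M N κ F (w + ((M : ℤ) * (N : ℤ)) • e μ') = tmean M N κ F w := fun w μ' => by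
    have h := congr_fun (tmean_translate M N κ F (((M : ℤ) * (N : ℤ)) • e μ')) w
    rw [← h]
    simp only [hFP]
  have hU : ∀ (w : Site d) (μ' : Fin d),
      tprim M N κ (F - tmean M N κ F) (w + ((M : ℤ) * (N : ℤ)) • e μ') = tprim M N κ (F - tmean M N κ F) w := fun w μ' => by
    have h := congr_fun (tprim_translate M N κ (F - tmean M N κ F) (((M : ℤ) * (N : ℤ)) • e μ')) w
    rw [← h]
    have : (fun y => (F - tmean M N κ F) (y + ((M : ℤ) * (N : ℤ)) • e μ')) = F - tmean M N κ F := by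
      funext x; simp only [Pi.sub_apply, hFP, hT]
    rw [this]
  have hMP : (M : ℤ) ∣ (M : ℤ) * (N : ℤ) := dvd_mul_right _ _
  simp only [llift, hT]
  rw [add_right_comm y _ (e κ), clift_per hMP κ hU (y + e κ) μ, clift_per hMP κ hU y μ]

/-- `llift` in direction `κ` preserves blockwise constancy in every other direction `ν`. [folklore] -/
theorem llift_bconst {M : ℕ} (N : ℕ) {κ ν : Fin d} (hne : ν ≠ κ) {F : Site d → X} (hFB : ∀ y, F y = F (y - (res M y ν) • e ν)) (y : Site d) :
    llift M N κ F y = llift M N κ F (y - (res M y ν) • e ν) := by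
  -- every translate along `κ` keeps `res_ν`, so `tmean`, `tprim` are blockwise constant in `ν`
  have hresκ : ∀ (w : Site d) (t : ℤ), res M (w + t • e κ) ν = res M w ν := fun w t => res_add_smul_e_ne M w hne.symm t
  have hT : ∀ w, tmean M N κ F w = tmean M N κ F (w - (res M w ν) • e ν) := fun w => by
    simp only [tmean]; congr 1
    refine Finset.sum_congr rfl fun k _ => ?_
    rw [hFB (w + _), hresκ, sub_add_eq_add_sub]
  have hG : ∀ w, (F - tmean M N κ F) w = (F - tmean M N κ F) (w - (res M w ν) • e ν) := fun w => by
    simp only [Pi.sub_apply]; rw [← hFB, ← hT]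
  have hU : ∀ w, tprim M N κ (F - tmean M N κ F) w = tprim M N κ (F - tmean M N κ F) (w - (res M w ν) • e ν) := fun w => by
    simp only [tprim]; congr 2
    refine Finset.sum_congr rfl fun k _ => ?_
    rw [hG (w + _), hresκ, sub_add_eq_add_sub]
  have hC := clift_bconst (M := M) (lam := κ) hne hU
  simp only [llift]
  rw [hC (y + e κ), hC y, hT y, show res M (y + e κ) ν = res M y ν from by simpa using hresκ y 1, add_sub_right_comm]

/-! ## §3 EXACTNESS: the block-line average of the longitudinal lift is the datum -/

/-- **EXACTNESS OF THE LONGITUDINAL LIFT**: for `F` blockwise constant in `κ` with `F(y + NM e_κ) = F y` (`M, N ≥ 1`) and a block start `y` (`res y_κ = 0`),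
`Σ_{s<M} Σ_{i<M} llift F (y + (s+i) e_κ) = M • F y` — Bałaban's block-LINE average along `κ` of the lift returns the datum. [folklore] -/
theorem sum_llift_line {M N : ℕ} (hM : 1 ≤ M) (hN : 1 ≤ N) (κ : Fin d) {F : Site d → X} (hF : ∀ y, F (y + ((M : ℤ) * (N : ℤ)) • e κ) = F y)
    (hFB : ∀ y, F y = F (y - (res M y κ) • e κ)) {y : Site d} (hy : res M y κ = 0) :
    ∑ s ∈ range M, ∑ i ∈ range M, llift M N κ F (y + ((s : ℤ) + (i : ℤ)) • e κ) = (M : ℝ) • F y := by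
  have hM0 : (M : ℝ) ≠ 0 := by exact_mod_cast (by omega : M ≠ 0)
  set G : Site d → X := F - tmean M N κ F with hGdef
  set U : Site d → X := tprim M N κ G with hUdef
  have hGB : ∀ w, G w = G (w - (res M w κ) • e κ) := fun w => by
    simp only [hGdef, Pi.sub_apply]; rw [← hFB, ← tmean_bconst hM N κ hFB]
  have hUB : ∀ w, U w = U (w - (res M w κ) • e κ) := tprim_bconst hM N κ hGB
  have hGP : ∀ w, G (w + ((M : ℤ) * (N : ℤ)) • e κ) = G w := fun w => by
    simp only [hGdef, Pi.sub_apply, hF, tmean_shift_mul κ hF w N]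
  have hUstep : ∀ w, U (w + (M : ℤ) • e κ) - U w = G w := tprim_step hN κ hGP (sum_translates_sub_tmean hN κ hF)
  have hy' : res M (y + (M : ℤ) • e κ) κ = 0 := by rw [res_add_M hM]; exact hy
  -- Part A: the derivative telescopes along the line, the block sums of `clift U` are exact
  have hA : ∑ s ∈ range M, ∑ i ∈ range M, (clift M κ U (y + ((s : ℤ) + (i : ℤ)) • e κ + e κ) - clift M κ U (y + ((s : ℤ) + (i : ℤ)) • e κ))
      = (M : ℝ) • G y := by
    have htel : ∀ s : ℕ, ∑ i ∈ range M, (clift M κ U (y + ((s : ℤ) + (i : ℤ)) • e κ + e κ) - clift M κ U (y + ((s : ℤ) + (i : ℤ)) • e κ))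
        = clift M κ U (y + (M : ℤ) • e κ + (s : ℤ) • e κ) - clift M κ U (y + (s : ℤ) • e κ) := by
      intro s
      have h := Finset.sum_range_sub (fun i => clift M κ U (y + ((s : ℤ) + (i : ℤ)) • e κ)) M
      have e1 : ∀ i : ℕ, y + ((s : ℤ) + ((i + 1 : ℕ) : ℤ)) • e κ = y + ((s : ℤ) + (i : ℤ)) • e κ + e κ := fun i => by push_cast; module
      have e2 : y + ((s : ℤ) + ((M : ℕ) : ℤ)) • e κ = y + (M : ℤ) • e κ + (s : ℤ) • e κ := by module
      have e3 : y + ((s : ℤ) + ((0 : ℕ) : ℤ)) • e κ = y + (s : ℤ) • e κ := by push_cast; module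
      simp only [e1, e2, e3] at h
      exact h
    simp only [htel, Finset.sum_sub_distrib, sum_clift_line hM κ hUB hy', sum_clift_line hM κ hUB hy, ← smul_sub, hUstep]
  -- Part B: `m̂` is constant along the two blocks
  have hB : ∑ s ∈ range M, ∑ i ∈ range M, (M : ℝ)⁻¹ • tmean M N κ F (y + ((s : ℤ) + (i : ℤ)) • e κ) = (M : ℝ) • tmean M N κ F y := by
    have h : ∀ s ∈ range M, ∀ i ∈ range M, (M : ℝ)⁻¹ • tmean M N κ F (y + ((s : ℤ) + (i : ℤ)) • e κ) = (M : ℝ)⁻¹ • tmean M N κ F y := by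
      intro s hs i hi
      have hs' := Finset.mem_range.mp hs
      have hi' := Finset.mem_range.mp hi
      rw [tmean_start hM κ hF hFB hy (by positivity) (by omega)]
    rw [Finset.sum_congr rfl fun s hs => Finset.sum_congr rfl fun i hi => h s hs i hi]
    simp only [Finset.sum_const, Finset.card_range, smul_smul, ← Nat.cast_smul_eq_nsmul ℝ]
    congr 1
    field_simp
  calc ∑ s ∈ range M, ∑ i ∈ range M, llift M N κ F (y + ((s : ℤ) + (i : ℤ)) • e κ)
      = ∑ s ∈ range M, ∑ i ∈ range M, ((clift M κ U (y + ((s : ℤ) + (i : ℤ)) • e κ + e κ) - clift M κ U (y + ((s : ℤ) + (i : ℤ)) • e κ))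
          + (M : ℝ)⁻¹ • tmean M N κ F (y + ((s : ℤ) + (i : ℤ)) • e κ)) := by rfl
    _ = (M : ℝ) • G y + (M : ℝ) • tmean M N κ F y := by
        simp only [Finset.sum_add_distrib, hA, hB]
    _ = (M : ℝ) • F y := by rw [hGdef, Pi.sub_apply, smul_sub, sub_add_cancel]

end Lift

end

end Summit.QuantumFields.BalabanUV.T4Continuum.NE7LongitudinalLineLift
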